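import Literature.MathematicalPhysics.QuantumFieldTheory.Balaban1983to89.B9Eq349BlockDecayFromKernel

/-!
# `Balaban1983to89.B9Eq349KernelConvolutionDecay` — T. Bałaban, *Propagators and renormalization transformations for lattice gauge theories. I*, Commun.
# Math. Phys. **95** (1984) 17–40 [Balaban1984PropagatorsI] p. 38, the sentence before (1.126) («They follow from the representation P = G′Q′*(Q′G′²Q′*)⁻¹Q′G′,
# from Lemma 2.4 of [2], and the representation (1.45) …»), with [Balaban1985BackgroundPropagators] (3.25) p. 394, (3.49) p. 399: **A COMPOSITION OF THREE
# KERNELS DECAYING AT RATE `κ` IN THE COARSE TORUS METRIC DECAYS AT ANY RATE `κ′ < κ`, WITH THE VOLUME-FREE CONSTANT `K_d(κ − κ′)²`; hence row L9's `hτ` for a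
# `T : L²(fine sites) → L²(bonds)` whose kernel is `A∗c∗B` over the coarse torus** — route R2′ STEP B8′ of the pub-balaban NE9 chain, road B8″ (the shape in which
# the flat `T(1) = (D_1G′Q̃′†)·(Q̃′G′²Q̃′†)⁻¹·(Q̃′G′)` arrives from the torus kernels of [B4] (2.48) and [B5′] (1.45))

statement-level skeleton of published theorems with citation tags; proofs where landed; nothing here is a claim about the Yang–Mills mass gap

CITATION HEADER (lean-in-tree rule).  Audit cell `pub-balaban`, sub-cell `t4`, BINDER row NE9; filed by NE9 formalisation-swarm LEAF PROVER 06
(`b2b-balaban-t4-ne9-formalise-leaf-06`, gen 68) as the sequel of `B9Eq349BlockDecayFromKernel` (same seat; road B8″ of `t4/ROUTES-NE9.md` v13.37 ADDENDUM (ii),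
t4-ne9-idea-1 gen 100).  Print composes three decaying kernels — `∂G′Q′*` ([B4] Lemma 2.4 (2.35) p. 582, on the torus: `B4Torus248Decay`), `(Q′G′²Q′*)⁻¹`
([B5′] (1.45): `B5Torus145Decay`, `B5QGGQ145Torus.torusKernel145M_conv_qggq`) and `Q′G′` — and reads off the decay of the composite without comment; this file
is that lattice-sum step on the cell's coarse torus `T_m` (`B4Sect5Torus.tdist`, `torusSum_le`).  Sources READ: [Balaban1984PropagatorsI] p. 38 through the
cell's audited header `B5Strip145`; [Balaban1985BackgroundPropagators] pp. 394, 399 in the held text (`paper:balaban1985-cmp99-background-propagators`).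

WHAT IS PROVED (sorry-free; proof lane — no `def`; [folklore] lattice sums).
* §1 (abstract, a pseudo-metric `δ` on a finite index `Y`, kernels valued in any normed ring `𝔸` — `ℂ` or `W →L[ℂ] W`): **`sum_sum_exp_triangle_le`**
  (`Σ_{y,y′} e^{−κδ(u,y)}e^{−κδ(y,y′)}e^{−κδ(y′,v)} ≤ S²·e^{−κ′δ(u,v)}` whenever `Σ_{y′} e^{−(κ−κ′)δ(y,y′)} ≤ S` for all `y`, `0 ≤ κ′ ≤ κ`: split `κ = κ′ + (κ−κ′)`,
  the `κ′`-part by the triangle inequality, the rest summed twice), **`norm_conv3_le`** (`k(b,x) = Σ_{y,y′} A(b,y)·c(y,y′)·B(y′,x)` with the three factors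
  decaying at rate `κ` from `π_E b`, between, to `π_S x` ⟹ `‖k(b,x)‖ ≤ K_AK_cK_B·S²·e^{−κ′δ(π_E b, π_S x)}`).
* §2 THE LATTICE LETTER (ne9-leaf-01's binders VERBATIM): **`block_decay_of_conv3_kernel`** — `(Tf)(b) = Σ_x k(b,x)•f(x)`, `k = A∗c∗B` over the coarse torus
  `T_m` with rates `κ`, any `0 ≤ κ′ < κ` ⟹ `‖P^B_{y₁} ∘L T ∘L P^S_{y₀}‖ ≤ √d·L^d·(K_AK_cK_B·K_d(κ−κ′)²)·e^{−(κ′·d_m(y₀,y₁))}` for all block families,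
  `K_d = B4Sect5Proof.latticeConst` — VOLUME-FREE (`B4Sect5Torus.torusSum_le`), by `B9Eq349BlockDecayFromKernel.block_decay_of_scalar_kernel`.
HONEST SCOPE.  Lattice sums only: no operator of the paper is given a kernel (road B8″ S1, NOT here); no rate is produced (`κ` a hypothesis); the loss
`κ → κ′` and the constant `K_d(κ−κ′)²` are crude (two full torus sums; no convexity bookkeeping).  ONE lattice-sum step of ONE sub-step (row L9's `hτ`) of
route R2′ STEP B8′, NOT NE9 (cell pub-balaban: NE9 NOT PRINTED ∕ NOT PROVED; «NE9 ⇐ the named binders»; row WALLED ON A MODEL (O-NE9-1; #5 UNRULED); spine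
PROVED 0∕9; rung (B)+1 on a finite T⁴ — NOT infinite volume, NOT mass gap, NOT Clay; HONEST DEPENDENCY: continuum YM on T⁴ ⇐ BetaPertH ∧ nine spine estimates
(0/9 proved); BetaPertH ⇐ (D1) ∧ (D4) ∧ CAP+tail; G-an2-4 gates asym, D1 and NE2/3/4).  NEW file importing `B9Eq349BlockDecayFromKernel` (this seat); nothing
modified.  Net new unproved facts: 0.
-/

noncomputable section

set_option autoImplicit false

open scoped BigOperators

namespace Literature.MathematicalPhysics.QuantumFieldTheory.Balaban1983to89.B9Eq349KernelConvolutionDecay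

open B4Sect5Torus (TSite tdist tdist_triangle tdist_nonneg torusSum_le)
open B4Sect5Proof (latticeConst latticeConst_nonneg)
open B9SectCLatticeCarrier (Bond bpos)
open B9Eq311L2Pairing (WL2)
open B9Eq319QprimeTorus (fineP blockCoord)
open B11Eq103H1Complex (SiteL2K BondL2K)
open B9Eq349BlockDecayFromKernel (block_decay_of_scalar_kernel)

/-! ## §1 Convolutions over a finite index with a pseudo-metric -/

section Conv

variable {Y : Type*} [Fintype Y] {δ : Y → Y → ℝ}
  (hδ0 : ∀ y y', 0 ≤ δ y y') (hδt : ∀ u y v, δ u v ≤ δ u y + δ y v)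

include hδ0 hδt in
/-- **THE TRIPLE EXPONENTIAL SUM**: if `Σ_{y′} e^{−(κ−κ′)δ(y,y′)} ≤ S` for every `y` (`0 ≤ κ′ ≤ κ`), then
`Σ_{y,y′} e^{−κδ(u,y)}·e^{−κδ(y,y′)}·e^{−κδ(y′,v)} ≤ S²·e^{−κ′δ(u,v)}` (split `κ = κ′ + (κ−κ′)`, the `κ′`-part by the triangle inequality, the rest summed
twice). [folklore] [cite: Balaban1985BackgroundPropagators, p.415 «random walk expansion»; Balaban1984PropagatorsI, p.38] -/
theorem sum_sum_exp_triangle_le {κ κ' S : ℝ} (hκ' : 0 ≤ κ') (hκκ : κ' ≤ κ) (hS : ∀ y, ∑ y', Real.exp (-((κ - κ') * δ y y')) ≤ S)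
    (u v : Y) :
    ∑ y, ∑ y', Real.exp (-(κ * δ u y)) * Real.exp (-(κ * δ y y')) * Real.exp (-(κ * δ y' v)) ≤ S ^ 2 * Real.exp (-(κ' * δ u v)) := by
  have hS0 : 0 ≤ S := (Finset.sum_nonneg fun y' _ => (Real.exp_pos _).le).trans (hS u)
  -- termwise: e^{−κa}e^{−κb}e^{−κc} ≤ e^{−κ′δ(u,v)} · e^{−(κ−κ′)a} · e^{−(κ−κ′)b}
  have hterm : ∀ y y', Real.exp (-(κ * δ u y)) * Real.exp (-(κ * δ y y')) * Real.exp (-(κ * δ y' v)) ≤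
      Real.exp (-(κ' * δ u v)) * (Real.exp (-((κ - κ') * δ u y)) * Real.exp (-((κ - κ') * δ y y'))) := by
    intro y y'
    rw [← Real.exp_add, ← Real.exp_add, ← Real.exp_add, ← Real.exp_add]
    apply Real.exp_le_exp.mpr
    have h1 := hδt u y v
    have h2 := hδt y y' v
    have h3 : κ' * δ u v ≤ κ' * (δ u y + δ y y' + δ y' v) := mul_le_mul_of_nonneg_left (by linarith) hκ'
    have h4 : 0 ≤ (κ - κ') * δ y' v := mul_nonneg (sub_nonneg.mpr hκκ) (hδ0 _ _)
    nlinarith [h3, h4]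
  calc ∑ y, ∑ y', Real.exp (-(κ * δ u y)) * Real.exp (-(κ * δ y y')) * Real.exp (-(κ * δ y' v))
      ≤ ∑ y, ∑ y', Real.exp (-(κ' * δ u v)) * (Real.exp (-((κ - κ') * δ u y)) * Real.exp (-((κ - κ') * δ y y'))) :=
        Finset.sum_le_sum fun y _ => Finset.sum_le_sum fun y' _ => hterm y y'
    _ = Real.exp (-(κ' * δ u v)) * ∑ y, (Real.exp (-((κ - κ') * δ u y)) * ∑ y', Real.exp (-((κ - κ') * δ y y'))) := by
        rw [Finset.mul_sum]
        refine Finset.sum_congr rfl fun y _ => ?_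
        rw [Finset.mul_sum, Finset.mul_sum]
    _ ≤ Real.exp (-(κ' * δ u v)) * ∑ y, (Real.exp (-((κ - κ') * δ u y)) * S) := by
        refine mul_le_mul_of_nonneg_left (Finset.sum_le_sum fun y _ => ?_) (Real.exp_pos _).le
        exact mul_le_mul_of_nonneg_left (hS y) (Real.exp_pos _).le
    _ = Real.exp (-(κ' * δ u v)) * ((∑ y, Real.exp (-((κ - κ') * δ u y))) * S) := by rw [Finset.sum_mul]
    _ ≤ Real.exp (-(κ' * δ u v)) * (S * S) :=
        mul_le_mul_of_nonneg_left (mul_le_mul_of_nonneg_right (hS u) hS0) (Real.exp_pos _).le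
    _ = S ^ 2 * Real.exp (-(κ' * δ u v)) := by ring

include hδ0 hδt in
/-- **A TRIPLE CONVOLUTION OF DECAYING KERNELS DECAYS** (values in any normed ring — scalars, or `W →L W` under composition): `k(b,x) = Σ_{y,y′} A(b,y)·c(y,y′)·B(y′,x)` with `‖A(b,y)‖ ≤ K_Ae^{−κδ(π_E b, y)}`,
`‖c(y,y′)‖ ≤ K_ce^{−κδ(y,y′)}`, `‖B(y′,x)‖ ≤ K_Be^{−κδ(y′, π_S x)}` ⟹ `‖k(b,x)‖ ≤ K_AK_cK_B·S²·e^{−κ′δ(π_E b, π_S x)}`. [folklore]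
[cite: Balaban1984PropagatorsI, p.38 «P = G′Q′*(Q′G′²Q′*)⁻¹Q′G′», (1.126); Balaban1985BackgroundPropagators, (3.49) p.399] -/
theorem norm_conv3_le {𝔸 : Type*} [NormedRing 𝔸] {XS XE : Type*} {πS : XS → Y} {πE : XE → Y}
    {A : XE → Y → 𝔸} {c : Y → Y → 𝔸} {B : Y → XS → 𝔸} {k : XE → XS → 𝔸}
    (hk : ∀ b x, k b x = ∑ y, ∑ y', A b y * c y y' * B y' x)
    {KA Kc KB κ κ' S : ℝ} (hKA0 : 0 ≤ KA) (hKc0 : 0 ≤ Kc) (hKB0 : 0 ≤ KB) (hκ' : 0 ≤ κ') (hκκ : κ' ≤ κ)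
    (hA : ∀ b y, ‖A b y‖ ≤ KA * Real.exp (-(κ * δ (πE b) y)))
    (hc : ∀ y y', ‖c y y'‖ ≤ Kc * Real.exp (-(κ * δ y y')))
    (hB : ∀ y' x, ‖B y' x‖ ≤ KB * Real.exp (-(κ * δ y' (πS x))))
    (hS : ∀ y, ∑ y', Real.exp (-((κ - κ') * δ y y')) ≤ S) (b : XE) (x : XS) :
    ‖k b x‖ ≤ KA * Kc * KB * S ^ 2 * Real.exp (-(κ' * δ (πE b) (πS x))) := by
  rw [hk]
  calc ‖∑ y, ∑ y', A b y * c y y' * B y' x‖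
      ≤ ∑ y, ∑ y', ‖A b y‖ * ‖c y y'‖ * ‖B y' x‖ := by
        refine (norm_sum_le _ _).trans (Finset.sum_le_sum fun y _ => (norm_sum_le _ _).trans (Finset.sum_le_sum fun y' _ => ?_))
        exact (norm_mul_le _ _).trans (mul_le_mul_of_nonneg_right (norm_mul_le _ _) (norm_nonneg _))
    _ ≤ ∑ y, ∑ y', (KA * Real.exp (-(κ * δ (πE b) y))) * (Kc * Real.exp (-(κ * δ y y'))) * (KB * Real.exp (-(κ * δ y' (πS x)))) := by
        refine Finset.sum_le_sum fun y _ => Finset.sum_le_sum fun y' _ => ?_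
        exact mul_le_mul (mul_le_mul (hA b y) (hc y y') (norm_nonneg _) (mul_nonneg hKA0 (Real.exp_pos _).le)) (hB y' x)
          (norm_nonneg _) (mul_nonneg (mul_nonneg hKA0 (Real.exp_pos _).le) (mul_nonneg hKc0 (Real.exp_pos _).le))
    _ = KA * Kc * KB * ∑ y, ∑ y', Real.exp (-(κ * δ (πE b) y)) * Real.exp (-(κ * δ y y')) * Real.exp (-(κ * δ y' (πS x))) := by
        rw [Finset.mul_sum]
        refine Finset.sum_congr rfl fun y _ => ?_
        rw [Finset.mul_sum]
        refine Finset.sum_congr rfl fun y' _ => ?_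
        ring
    _ ≤ KA * Kc * KB * (S ^ 2 * Real.exp (-(κ' * δ (πE b) (πS x)))) :=
        mul_le_mul_of_nonneg_left (sum_sum_exp_triangle_le hδ0 hδt hκ' hκκ hS _ _) (by positivity)
    _ = KA * Kc * KB * S ^ 2 * Real.exp (-(κ' * δ (πE b) (πS x))) := by ring

end Conv

/-! ## §2 The lattice letter: row L9's `hτ` for a kernel composed over the coarse torus -/

section Lattice

variable {d : ℕ} {L : ℕ} [NeZero L] {m : Fin d → ℕ} {c₀ : ℝ} [Fact (0 < c₀)]
  {W : Type*} [NormedAddCommGroup W] [InnerProductSpace ℂ W]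

/-- **… FROM A TRIPLE COARSE CONVOLUTION** (the shape in which `T(1) = (D_1G′Q̃′†)·(Q̃′G′²Q̃′†)⁻¹·(Q̃′G′)` arrives from the flat torus kernels):
`k(b,x) = Σ_{y,y′ ∈ T_m} A(b,y)·c(y,y′)·B(y′,x)` with `‖A(b,y)‖ ≤ K_Ae^{−κ·d_m(blk(b₋),y)}`, `‖c(y,y′)‖ ≤ K_ce^{−κ·d_m(y,y′)}`, `‖B(y′,x)‖ ≤ K_Be^{−κ·d_m(y′,blk x)}`
and ANY slower rate `0 ≤ κ′ < κ` ⟹ `hτ` with `C_τ := √d·L^d·K_AK_cK_B·K_d(κ−κ′)²`, `r := κ′` — `K_d = latticeConst`, VOLUME-FREE (`B4Sect5Torus.torusSum_le`).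
[folklore] [cite: Balaban1984PropagatorsI, p.38 «P = G′Q′*(Q′G′²Q′*)⁻¹Q′G′», (1.126); Balaban1985BackgroundPropagators, (3.49) p.399, (3.25) p.394] -/
theorem block_decay_of_conv3_kernel (hm : ∀ i, 1 ≤ m i)
    (T : SiteL2K ℂ d (fineP L m) c₀ W →L[ℂ] BondL2K ℂ d (fineP L m) c₀ W)
    (k : Bond d (fineP L m) → TSite d (fineP L m) → ℂ)
    (hT : ∀ (f : SiteL2K ℂ d (fineP L m) c₀ W) (b : Bond d (fineP L m)),
      WL2.equiv ℂ (fun _ : Bond d (fineP L m) => c₀) W (T f) b = ∑ x, k b x • WL2.equiv ℂ (fun _ : TSite d (fineP L m) => c₀) W f x)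
    {A : Bond d (fineP L m) → TSite d m → ℂ} {c : TSite d m → TSite d m → ℂ} {B : TSite d m → TSite d (fineP L m) → ℂ}
    (hk : ∀ b x, k b x = ∑ y, ∑ y', A b y * c y y' * B y' x)
    {KA Kc KB κ κ' : ℝ} (hKA0 : 0 ≤ KA) (hKc0 : 0 ≤ Kc) (hKB0 : 0 ≤ KB) (hκ' : 0 ≤ κ') (hκκ : κ' < κ)
    (hA : ∀ b y, ‖A b y‖ ≤ KA * Real.exp (-(κ * tdist m (blockCoord L m (bpos b)) y)))
    (hc : ∀ y y', ‖c y y'‖ ≤ Kc * Real.exp (-(κ * tdist m y y')))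
    (hB : ∀ y' x, ‖B y' x‖ ≤ KB * Real.exp (-(κ * tdist m y' (blockCoord L m x)))) :
    ∀ (PS : TSite d m → SiteL2K ℂ d (fineP L m) c₀ W →L[ℂ] SiteL2K ℂ d (fineP L m) c₀ W),
      (∀ (y : TSite d m) (f : SiteL2K ℂ d (fineP L m) c₀ W) (x : TSite d (fineP L m)),
        WL2.equiv ℂ (fun _ : TSite d (fineP L m) => c₀) W (PS y f) x =
          if blockCoord L m x = y then WL2.equiv ℂ (fun _ : TSite d (fineP L m) => c₀) W f x else 0) →
      ∀ (PB : TSite d m → BondL2K ℂ d (fineP L m) c₀ W →L[ℂ] BondL2K ℂ d (fineP L m) c₀ W),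
      (∀ (y : TSite d m) (g : BondL2K ℂ d (fineP L m) c₀ W) (b : Bond d (fineP L m)),
        WL2.equiv ℂ (fun _ : Bond d (fineP L m) => c₀) W (PB y g) b =
          if blockCoord L m (bpos b) = y then WL2.equiv ℂ (fun _ : Bond d (fineP L m) => c₀) W g b else 0) →
      ∀ y₀ y₁ : TSite d m, ‖PB y₁ ∘L T ∘L PS y₀‖ ≤
        Real.sqrt d * (L : ℝ) ^ d * (KA * Kc * KB * latticeConst d (κ - κ') ^ 2) * Real.exp (-(κ' * tdist m y₀ y₁)) :=
  block_decay_of_scalar_kernel hm T k hT (by have := latticeConst_nonneg d (sub_pos.mpr hκκ).le; positivity)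
    (norm_conv3_le (δ := tdist m) (tdist_nonneg m) (tdist_triangle hm) hk hKA0 hKc0 hKB0 hκ' hκκ.le hA hc hB
      (fun y => torusSum_le d hm (sub_pos.mpr hκκ) y))

end Lattice

end Literature.MathematicalPhysics.QuantumFieldTheory.Balaban1983to89.B9Eq349KernelConvolutionDecay

end
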